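/-
Origin: expansion seat `prover-pub-hodgecm-mc-binder-2-g7-0`, handover #19 19:45Z md5 78b8f40de579 (123 l.; (J-vac) READ-OFF of pv11's pinned printed vacuum characters against the kernel exponents: §1 `vacScalar_torusLetter` (`vacScalar e (torusLetter t) = t₁^{∣R'∣e_R} t₂^{∣S'∣e_S}`), `vacScalar_torusLetter_of_card_eq_one` (`= t₁^{e_R} t₂^{e_S}`, census slot), `vacScalar_iotaTorusLetter` (`vacScalar e ((1,1),(diag(t₁,t₂),1)) = (t₁t₂)^{e_R}`); §2 **`coe_pinnedVac_sigma_eq_vacScalar_torusLetter`** (Σ₁₂: `m₁ = -e_R ∧ m₂ = -e_S ⇒ pinnedVac Σ₁₂ m₁ m₂ u = vacScalar e (torusLetter u)`), **`coe_pinnedVac_delta_eq_vacScalar_iotaTorusLetter`** (D₁₂: `m₁ = m₂ = -e_R`), **`coe_pinnedVac_iota_mul_eq_…_mul`** / **`coe_pinnedVac_iota_eq_vacScalar_iotaTorusLetter`** (ι₁: `m₁ = m₂ = -e_R - 1`, the `det z` weight `u₁u₂` on both sides), `coe_pinnedVacs_eq_vacScalar_torusLetter_of_sigma` (through pv11's bundle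 `pinnedVacs kind m₁ m₂ b`); private mirror `lean -o` rc 0 / 0 err / 0 warn / 10.5 s, `#print axioms` trio (`g7/certs/VacReadOff_mirror.txt`)) (`HOME/mc/pub-hodgecm-mc-binder-2/g7/pkg/HodgeCM/Model/HypCensus/VacReadOff.lean`, md5 78b8f40d, 123 lines);
landed by the gen-13 packager (p-g13) in gate run 37 as `HodgeCM/Model/HypCensus/VacReadOff.lean` (verbatim).
-/
/-
Origin: speedrun cell pub-hodgecm, MODEL-CONSTRUCTION sub-cell, lineage mc-binder-2 (rows A12/A34 of the binder ledger:
`hyp12` / `hyp34`), seat prover-pub-hodgecm-mc-binder-2-g7-0 (gen 7), 2026-08-19.  Target in PKG: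
`HodgeCM/Model/HypCensus/VacReadOff.lean` (NEW additive leaf; imports this lineage's `IotaDictionary` and PKG
`HodgeCM.PerL34.PrintedTorusMatch` (pv11) — all PRESENT in PKG).  KERNEL only: 0 records / named facts / proof holes.
-/
import Summits.HodgeConjecture.HodgeCM.Model.HypCensus.IotaDictionary
import Summits.HodgeConjecture.HodgeCM.PerL34.PrintedTorusMatch_2

/-!
# Census kit (rows A12/A34), (J-vac): the READ-OFF of the pinned printed vacuum characters against the kernel exponents

pv11's `pinnedVacs kind m₁ m₂ b = pinnedVac (kind b) (m₁ b) (m₂ b)` prescribes, per real place `b`, the vacuum character of the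
printed local Fock model: `u ↦ u₁^{-m₁} u₂^{-m₂}` at `Σ₁₂`/`D₁₂`, `u ↦ u₁^{-m₁-1} u₂^{-m₂-1}` at `ι₁` (`PrintedTorusMatch`).  On the
kernel side Konno–Konno's compact group acts on the Fock-polynomial vectors through `vacScalar e_b` (`KappaEigen` #18,
`e_b = placeVacExponents …` #17) composed with the dictionaries' substitutions (#14 `torusLetter`, #16 `iotaTorusLetter`).
This file evaluates `vacScalar` on the two torus letters and records WHEN the printed scalar equals the kernel scalar:

* §1 `vacScalar_torusLetter : vacScalar e (torusLetter t) = t₁^{|R'|·e_R} · t₂^{|S'|·e_S}`, `vacScalar_torusLetter_of_card_eq_one`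
  (`= t₁^{e_R} t₂^{e_S}` in the census slot `|R'| = |S'| = 1`), `vacScalar_iotaTorusLetter : vacScalar e (iotaTorusLetter eR t) = (t₁t₂)^{e_R}`;
* §2 READ-OFF (the exponent identities under which `omg_ins` holds place by place, torus coordinates matched by (J-T12) as `u = t`):
  **`coe_pinnedVac_sigma_eq_vacScalar_torusLetter`** (`Σ₁₂`: `m₁ = -e_R`, `m₂ = -e_S`),
  **`coe_pinnedVac_delta_eq_vacScalar_iotaTorusLetter`** (`D₁₂`, torus `diag(u₁,u₂)` in the positive `W`-block: `m₁ = m₂ = -e_R`),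
  **`coe_pinnedVac_iota_mul_eq_vacScalar_iotaTorusLetter_mul`** (`ι₁`: the printed eigenvalue on `det z` is `vac(u)·u₁u₂`, the
  kernel one `vacScalar e (iotaTorusLetter u) · u₁u₂` (#16): equal iff `vac u = (u₁u₂)^{e_R}`, i.e. `m₁ = m₂ = -e_R - 1`).

The negative-block (`S'`) twins are the role-swapped statements (tree `RealUnitaryDualPairNegate`).  Nothing here is a claim of
PerL/QW8.  Style lint (L-notation): no `local notation`.
-/

set_option autoImplicit false

noncomputable section

open MvPolynomial Complex
open scoped BigOperators ComplexConjugate Kronecker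
open Literature.Analysis.SegalBargmann
open Literature.RepresentationTheory.KonnoKonno2007 Literature.RepresentationTheory.KonnoKonno2007.RealDualPair
open HodgeCM.PerL34 HodgeCM.PerL34.Fock HodgeCM.PerL34.Fock.PrintDict

namespace HodgeCM.Model.HypCensus

section ReadOff

variable {P' Q' R' S' : Type} [Fintype P'] [DecidableEq P'] [Fintype Q'] [DecidableEq Q'] [Fintype R'] [DecidableEq R']
  [Fintype S'] [DecidableEq S']

/-! ## §1 `vacScalar` on the torus letters -/

/-- **`vacScalar` on the `W`-torus letter** `k_t = ((1,1),(t₁•1,t₂•1))`: `= t₁^{|R'| e_R} · t₂^{|S'| e_S}`. [folklore] -/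
theorem vacScalar_torusLetter (ev : VacExponents) (t : Circle × Circle) :
    vacScalar ev (torusLetter Q' t : DPK P' Q' R' S') =
      ((t.1 : Circle) : ℂ) ^ ((Fintype.card R' : ℤ) * ev.eR) * ((t.2 : Circle) : ℂ) ^ ((Fintype.card S' : ℤ) * ev.eS) := by
  simp only [vacScalar, torusLetter, OneMemClass.coe_one, Matrix.det_one, one_zpow, one_mul, coe_circleScalarUnitary,
    Matrix.det_smul, mul_one, ← zpow_natCast, ← zpow_mul]

/-- … in the census slot (`W_b ≅ U(1,1)`: `|R'| = |S'| = 1`): `vacScalar e k_t = t₁^{e_R} · t₂^{e_S}`. [folklore] -/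
theorem vacScalar_torusLetter_of_card_eq_one (ev : VacExponents) (hR : Fintype.card R' = 1) (hS : Fintype.card S' = 1)
    (t : Circle × Circle) :
    vacScalar ev (torusLetter Q' t : DPK P' Q' R' S') = ((t.1 : Circle) : ℂ) ^ ev.eR * ((t.2 : Circle) : ℂ) ^ ev.eS := by
  rw [vacScalar_torusLetter, hR, hS, Nat.cast_one, one_mul, one_mul]

/-- **`vacScalar` on the torus letter `((1,1),(diag(t₁,t₂),1))`** (places `ι₁` / `D₁₂`, torus in the positive `W`-block of rank 2):
`= (t₁ t₂)^{e_R}`. [folklore] -/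
theorem vacScalar_iotaTorusLetter (ev : VacExponents) (eR : Fin 2 ≃ R') (t : Circle × Circle) :
    vacScalar ev (iotaTorusLetter eR t : DPK P' Q' R' S') = (((t.1 : Circle) : ℂ) * ((t.2 : Circle) : ℂ)) ^ ev.eR := by
  simp only [vacScalar, iotaTorusLetter, OneMemClass.coe_one, Matrix.det_one, one_zpow, one_mul, mul_one, coe_diagCircleUnitary,
    Matrix.det_diagonal]
  rw [eR.symm.prod_comp fun j => (((![t.1, t.2] j : Circle)) : ℂ), Fin.prod_univ_two, Matrix.cons_val_zero, Matrix.cons_val_one,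
    Matrix.cons_val_fin_one]

/-! ## §2 The read-off identities -/

/-- **READ-OFF at a `Σ₁₂` place**: with `m₁ = -e_R`, `m₂ = -e_S` (census slot `|R'| = |S'| = 1`) the pinned printed vacuum character IS
the kernel scalar on the `W`-torus letter: `pinnedVac Σ₁₂ m₁ m₂ u = vacScalar e k_u`. [folklore] -/
theorem coe_pinnedVac_sigma_eq_vacScalar_torusLetter (ev : VacExponents) (hR : Fintype.card R' = 1) (hS : Fintype.card S' = 1)
    {n₁ n₂ : ℤ} (h₁ : n₁ = -ev.eR) (h₂ : n₂ = -ev.eS) (u : Circle × Circle) :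
    ((pinnedVac .sigma n₁ n₂ u : Circle) : ℂ) = vacScalar ev (torusLetter Q' u : DPK P' Q' R' S') := by
  rw [vacScalar_torusLetter_of_card_eq_one ev hR hS, h₁, h₂]
  show ((circleZPow (- -ev.eR) (- -ev.eS) u : Circle) : ℂ) = _
  rw [neg_neg, neg_neg, coe_circleZPow]

/-- **READ-OFF at a `D₁₂` place** (torus `diag(u₁,u₂)` in the positive `W`-block): with `m₁ = m₂ = -e_R`,
`pinnedVac D₁₂ m₁ m₂ u = vacScalar e ((1,1),(diag(u₁,u₂),1))`. [folklore] -/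
theorem coe_pinnedVac_delta_eq_vacScalar_iotaTorusLetter (ev : VacExponents) (eR : Fin 2 ≃ R') {n₁ n₂ : ℤ} (h₁ : n₁ = -ev.eR)
    (h₂ : n₂ = -ev.eR) (u : Circle × Circle) :
    ((pinnedVac .delta n₁ n₂ u : Circle) : ℂ) = vacScalar ev (iotaTorusLetter eR u : DPK P' Q' R' S') := by
  rw [vacScalar_iotaTorusLetter, h₁, h₂, mul_zpow]
  show ((circleZPow (- -ev.eR) (- -ev.eR) u : Circle) : ℂ) = _
  rw [neg_neg, coe_circleZPow]

/-- **READ-OFF at the `ι₁` place** (printed line `det z`, torus `diag(u₁,u₂)` in the positive `W`-block): with `m₁ = m₂ = -e_R - 1` the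
printed eigenvalue `pinnedVac ι₁ m₁ m₂ u · (u₁u₂)` equals the kernel eigenvalue `vacScalar e ((1,1),(diag(u₁,u₂),1)) · (u₁u₂)` of #16/#18.
[folklore] -/
theorem coe_pinnedVac_iota_mul_eq_vacScalar_iotaTorusLetter_mul (ev : VacExponents) (eR : Fin 2 ≃ R') {n₁ n₂ : ℤ}
    (h₁ : n₁ = -ev.eR - 1) (h₂ : n₂ = -ev.eR - 1) (u : Circle × Circle) :
    ((pinnedVac .iota n₁ n₂ u : Circle) : ℂ) * (((u.1 : Circle) : ℂ) * ((u.2 : Circle) : ℂ)) =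
      vacScalar ev (iotaTorusLetter eR u : DPK P' Q' R' S') * (((u.1 : Circle) : ℂ) * ((u.2 : Circle) : ℂ)) := by
  rw [vacScalar_iotaTorusLetter, h₁, h₂, mul_zpow]
  show ((circleZPow (-(-ev.eR - 1) - 1) (-(-ev.eR - 1) - 1) u : Circle) : ℂ) * _ = _
  rw [show -(-ev.eR - 1) - 1 = ev.eR by ring, coe_circleZPow]

/-- … hence (no zero divisors on the circle) `pinnedVac ι₁ m₁ m₂ u = vacScalar e ((1,1),(diag(u₁,u₂),1))` itself. [folklore] -/
theorem coe_pinnedVac_iota_eq_vacScalar_iotaTorusLetter (ev : VacExponents) (eR : Fin 2 ≃ R') {n₁ n₂ : ℤ}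
    (h₁ : n₁ = -ev.eR - 1) (h₂ : n₂ = -ev.eR - 1) (u : Circle × Circle) :
    ((pinnedVac .iota n₁ n₂ u : Circle) : ℂ) = vacScalar ev (iotaTorusLetter eR u : DPK P' Q' R' S') :=
  mul_right_cancel₀ (mul_ne_zero (Circle.coe_ne_zero u.1) (Circle.coe_ne_zero u.2))
    (coe_pinnedVac_iota_mul_eq_vacScalar_iotaTorusLetter_mul ev eR h₁ h₂ u)

/-- **the three read-offs through `pinnedVacs`** (pv11's per-place bundle): at a place `b` of kind `Σ₁₂` with `m₁ b = -e_R`, `m₂ b = -e_S`,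
`pinnedVacs kind m₁ m₂ b u = vacScalar e (torusLetter u)`. [folklore] -/
theorem coe_pinnedVacs_eq_vacScalar_torusLetter_of_sigma {RP : Type} (kind : RP → PlaceKind) (m₁ m₂ : RP → ℤ) (b : RP)
    (hb : kind b = .sigma) (ev : VacExponents) (hR : Fintype.card R' = 1) (hS : Fintype.card S' = 1) (h₁ : m₁ b = -ev.eR)
    (h₂ : m₂ b = -ev.eS) (u : Circle × Circle) :
    ((pinnedVacs kind m₁ m₂ b u : Circle) : ℂ) = vacScalar ev (torusLetter Q' u : DPK P' Q' R' S') := by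
  rw [pinnedVacs_apply, hb]
  exact coe_pinnedVac_sigma_eq_vacScalar_torusLetter ev hR hS h₁ h₂ u

end ReadOff

end HodgeCM.Model.HypCensus

end
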